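import Summits.CriticalPhenomena.PercolationContinuityZ3.Theses.PercExchangeRateTransport

/-!
# Line `birth` — registered skeleton for the crux `CriticalCurveRegular`
# (stmt-CriticalPhenomena-16065, route `PercExchangeRateTransport`, ledger rank 9, a binder of `closes`)

Crux (fixed, by name): `PercExchangeRateTransport.CriticalCurveRegular` — for the label-coupled
anisotropic bond family on `ℤ²×ℤ` (labels `U_e` i.i.d. uniform under `μ = labelMeasure (Site 3)`;
an `x`- or `y`-bond is open iff `U_e ≤ p`, a `z`-bond iff `U_e ≤ t`), with
`θ(p,t) = μ{U | 0 percolates}` and `p_c(t) = sInf ({p ∈ [0,1] | θ(p,t) > 0} ∪ {1})`: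
`ContinuousOn p_c (0,1) ∧ ∀ t ∈ (0,1), 0 < p_c(t) < 1`.

THE LINE = the crux's own informal proof (route docstring: "two-sided Aizenman–Grimmett
comparability … gives local Lipschitz continuity exactly as in Chayes–Schonmann's mixed site–bond
curve; `p_c(t) ≥ (1−t)/8` by path counting with vertical runs, `p_c(t) ≤ p_c(ℤ²) < 1` by
monotonicity in `t`"), cut at its THREE MECHANISMS, each a derivative-free statement about the
infinite-volume density `θ(p,t)` only (no `deriv`, no finite-volume `Θ_n`, so no junk values and the
prover of each stub chooses the finite-volume approximation):

* `stub_smallDensityNoPercolation` (path counting WITH VERTICAL RUNS; size M): `θ(p,t) = 0` whenever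
  `0 ≤ t < 1`, `0 ≤ p` and `8p < 1 − t`. An open self-avoiding path from `0` with `N` horizontal steps
  is a word (vertical run `j₀ ∈ ℤ`, horizontal step, run `j₁`, …); the expected number of open ones
  is `≤ (4p · Σ_{j∈ℤ} t^{|j|})^N = (4p(1+t)/(1−t))^N < ((1+t)/2)^N → 0`, and a path with finitely
  many horizontal steps ends in an infinite open vertical ray (probability `0` for `t < 1`). Tree
  engine to adapt: `theta_zd_le_pow` / `exists_word_of_walk` (CriticalContinuityProofs, isotropic).
  Gives `p_c(t) ≥ (1−t)/8 > 0`.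
* `stub_planarMinorant` (coupling to the plane; size M): `θ_{ℤ²}(p) ≤ θ(p,t)` for every
  `p ∈ [0,1]` and every real `t` — the horizontal bonds of the plane `ℤ²×{0}` with `U_e ≤ p` form a
  sub-configuration whose law under `μ` is `bondPercolation (zdGraph 2) p` (push-forward of the
  product label measure along `exists_zdGraph_two_embedding`, cf. `map_configOfLabels`), and plane
  percolation at `0` forces percolation at `0`. With the TREE theorems `0 < p_c(ℤ²) < 1`
  (`Grimmett1999_criticalProb_pos_lt_one_holds`) and `θ > 0` above `p_c`
  (`theta_pos_of_criticalProb_lt_holds`) it gives `p_c(t) ≤ (p_c(ℤ²)+1)/2 < 1`.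
* `stub_shearMonotone` (AIZENMAN–GRIMMETT, the load-bearing stub; size L / folklore-open for this
  family): on every compact rectangle `[plo,phi] × [lo,hi] ⊂ (0,1)²` there is `C ≥ 0` with
  `θ(p,t) ≤ θ(p + C|t−s|, s)` for `s,t ∈ [lo,hi]`, `plo ≤ p`, `p + C|t−s| ≤ phi`: lowering the
  vertical density by `h` is compensated by raising the planar density by `Ch` (for `s > t` it is
  plain monotonicity). This is the integrated, infinite-volume form of the finite-volume
  comparability `∂_tΘ_n ≤ C ∂_pΘ_n` (pivotality of a `z`-bond converted into pivotality of nearby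
  `xy`-bonds by local modification, constants uniform in `n` on compacts of the open square;
  AizenmanGrimmett1991, Grimmett1999 §3.3, BalisterBollobasRiordan2014, ChayesSchonmann2000 Thm 1.4
  template), followed by `θ = inf_n Θ_n`. Tree engine to instantiate: `AGLine.LocMod`,
  `AGLine.sum_piv_inl_le`, `AGLine.hasDerivAt_theta_line`, `AGLine.theta_line_mono`
  (`Literature/Probability/Percolation/EnhancementAGLine.lean`, the abstract AG differential
  inequality + line-segment argument, with `K_E :=` vertical and `K_V :=` horizontal bonds of `Λ_n`).
* `CriticalCurveRegular_of : Stubs.stub_smallDensityNoPercolation → Stubs.stub_planarMinorant →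
  Stubs.stub_shearMonotone → CriticalCurveRegular` (stub `Prop`s BY NAME, conclusion the route decl
  BY NAME) is PROVED here through the percolation-free real-variable core `curve_regular_core`
  (≈ 110 lines): from the `sInf ∪ {1}` definition of `p_c`, (i) `(1−t)/8 ≤ p_c(t)` (every density
  with `θ > 0` violates `8p < 1−t`), (ii) `p_c(t) ≤ q₀ := (p_c(ℤ²)+1)/2 < 1`, (iii) for `s,t` in a
  compact sub-arc around `t₀` and `C|t−s| ≤ (1−q₀)/4`: `p_c(s) ≤ p_c(t) + C|t−s|` (take `q` just
  above `p_c(t)` with `θ(q,t) > 0`; by (i) `q ≥ plo`, by (ii) `q + C|t−s| ≤ phi`; the shear gives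
  `θ(q + C|t−s|, s) > 0`, so `p_c(s) ≤ q + C|t−s|`), whence `|p_c(x) − p_c(t₀)| ≤ C|x − t₀|` near
  `t₀` and continuity within `(0,1)` by an `ε/(C+1)` choice of `δ`.
* `CriticalCurveRegular_proof : CriticalCurveRegular := CriticalCurveRegular_of stub… stub… stub…` —
  the skeleton IS the crux proof once the three sorries are discharged.

Disproof used: none filed for this crux (`ledger crux ls stmt-CriticalPhenomena-16065`: no workfiles,
2026-08-17; no `Theorems/CriticalCurveRegular/Negative/*`). Negatives index (11 statements; 3 on this
sub: TiltGluing, CoverIsCovering, QuarantineInequality): no stub is a crossing/gluing/quarantine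
inequality. Grounder notes on the item honoured: CoutoLimaSanchis2013 Thm 1 (continuity known in print
for SLABS `ℤ²×{0..k}` only) and Sanchis–Silva 2017 (monotonicity of the curve only) — the open content
is isolated in `stub_shearMonotone`; "tree AG line engine gives the Lipschitz step given LocMod
witnesses" = exactly the prover's route into that stub. No new route, no restatement of the crux.
-/

noncomputable section

open MeasureTheory Set
open Literature.Probability.Percolation (theta criticalProb labelMeasure percolatesAt
  theta_pos_of_criticalProb_lt_holds Grimmett1999_criticalProb_pos_lt_one_holds)
open Literature.Probability.LatticeModels (Site zdGraph)

namespace Summit.CriticalPhenomena.PercolationContinuityZ3.Cruxes.CriticalCurveRegular.Birth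

/-! ## The three registered stubs: precise `Prop`s `Stubs.stub_*` + sorried theorems `stub_*` -/

namespace Stubs

/-- **Stub `Prop` 1 (path counting with vertical runs)** — in the label-coupled anisotropic family,
`θ(p,t) = 0` whenever `0 ≤ t < 1`, `0 ≤ p` and `8p < 1 − t` (so `p_c(t) ≥ (1−t)/8 > 0`). -/
def stub_smallDensityNoPercolation : Prop :=
  let μ := Literature.Probability.Percolation.labelMeasure (Literature.Probability.LatticeModels.Site 3); let vert : Sym2 (Literature.Probability.LatticeModels.Site 3) → Prop := fun e => ∃ x : Literature.Probability.LatticeModels.Site 3, e = s(x, x + Pi.single (2 : Fin 3) 1); let cfg : ℝ → ℝ → (Sym2 (Literature.Probability.LatticeModels.Site 3) → ℝ) → Set (Sym2 (Literature.Probability.LatticeModels.Site 3)) := fun p t U => {e | e ∈ (Literature.Probability.LatticeModels.zdGraph 3).edgeSet ∧ ((vert e ∧ U e ≤ t) ∨ (¬ vert e ∧ U e ≤ p))}; let θ : ℝ → ℝ → ℝ := fun p t => μ.real {U | cfg p t U ∈ Literature.Probability.Percolation.percolatesAt (0 : Literature.Probability.LatticeModels.Site 3)}; ∀ t p : ℝ,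 0 ≤ t → t < 1 → 0 ≤ p → 8 * p < 1 - t → θ p t = 0

/-- **Stub `Prop` 2 (planar minorant)** — the plane `ℤ²×{0}` percolating at density `p` forces the
anisotropic model to percolate: `θ_{ℤ²}(p) ≤ θ(p,t)` for every `p ∈ [0,1]` and every real `t`
(with the tree theorems `p_c(ℤ²) < 1`, `θ_{ℤ²} > 0` above `p_c(ℤ²)` this gives `p_c(t) < 1`). -/
def stub_planarMinorant : Prop :=
  let μ := Literature.Probability.Percolation.labelMeasure (Literature.Probability.LatticeModels.Site 3); let vert : Sym2 (Literature.Probability.LatticeModels.Site 3) → Prop := fun e => ∃ x : Literature.Probability.LatticeModels.Site 3, e = s(x, x + Pi.single (2 : Fin 3) 1); let cfg : ℝ → ℝ → (Sym2 (Literature.Probability.LatticeModels.Site 3) → ℝ) → Set (Sym2 (Literature.Probability.LatticeModels.Site 3)) := fun p t U => {e | e ∈ (Literature.Probability.LatticeModels.zdGraph 3).edgeSet ∧ ((vert e ∧ U e ≤ t) ∨ (¬ vert e ∧ U e ≤ p))}; let θ : ℝ → ℝ → ℝ := fun p t => μ.real {U | cfg p t U ∈ Literature.Probability.Percolation.percolatesAt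 (0 : Literature.Probability.LatticeModels.Site 3)}; ∀ p : unitInterval, ∀ t : ℝ, Literature.Probability.Percolation.theta (Literature.Probability.LatticeModels.zdGraph 2) 0 p ≤ θ p t

/-- **Stub `Prop` 3 (Aizenman–Grimmett shear monotonicity, the load-bearing stub)** — on every
compact rectangle `[plo,phi] × [lo,hi] ⊂ (0,1)²` there is `C ≥ 0` such that lowering the vertical
density from `t` to `s` is compensated by raising the planar density by `C|t−s|`:
`θ(p,t) ≤ θ(p + C|t−s|, s)` (integrated form of `∂_tΘ_n ≤ C ∂_pΘ_n`, uniform in `n`). -/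
def stub_shearMonotone : Prop :=
  let μ := Literature.Probability.Percolation.labelMeasure (Literature.Probability.LatticeModels.Site 3); let vert : Sym2 (Literature.Probability.LatticeModels.Site 3) → Prop := fun e => ∃ x : Literature.Probability.LatticeModels.Site 3, e = s(x, x + Pi.single (2 : Fin 3) 1); let cfg : ℝ → ℝ → (Sym2 (Literature.Probability.LatticeModels.Site 3) → ℝ) → Set (Sym2 (Literature.Probability.LatticeModels.Site 3)) := fun p t U => {e | e ∈ (Literature.Probability.LatticeModels.zdGraph 3).edgeSet ∧ ((vert e ∧ U e ≤ t) ∨ (¬ vert e ∧ U e ≤ p))}; let θ : ℝ → ℝ → ℝ := fun p t => μ.real {U | cfg p t U ∈ Literature.Probability.Percolation.percolatesAt (0 : Literature.Probability.LatticeModels.Site 3)}; ∀ lo hi plo phi : ℝ, 0 < lo → lo ≤ hi → hi < 1 → 0 < plo → plo ≤ phi → phi < 1 → ∃ C : ℝ, 0 ≤ C ∧ ∀ s ∈ Set.Icc lo hi, ∀ t ∈ Set.Icc lo hi, ∀ p : ℝ, plo ≤ p → p + C * |t - s| ≤ phi → θ p t ≤ θ (p + C * |t - s|) s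

end Stubs

/-- **stub 1 (registered) = `Stubs.stub_smallDensityNoPercolation` spelled out** — path counting
with vertical runs: `θ(p,t) = 0` for `0 ≤ t < 1`, `0 ≤ p`, `8p < 1 − t`. Size M (union bound over
words with `N` horizontal steps, weight `(4p(1+t)/(1−t))^N`; a.s. no infinite open vertical ray). -/
theorem stub_smallDensityNoPercolation :
    let μ := Literature.Probability.Percolation.labelMeasure (Literature.Probability.LatticeModels.Site 3); let vert : Sym2 (Literature.Probability.LatticeModels.Site 3) → Prop := fun e => ∃ x : Literature.Probability.LatticeModels.Site 3, e = s(x, x + Pi.single (2 : Fin 3) 1); let cfg : ℝ → ℝ → (Sym2 (Literature.Probability.LatticeModels.Site 3) → ℝ) → Set (Sym2 (Literature.Probability.LatticeModels.Site 3)) := fun p t U => {e | e ∈ (Literature.Probability.LatticeModels.zdGraph 3).edgeSet ∧ ((vert e ∧ U e ≤ t) ∨ (¬ vert e ∧ U e ≤ p))}; let θ : ℝ → ℝ → ℝ := fun p t => μ.real {U | cfg p t U ∈ Literature.Probability.Percolation.percolatesAt (0 : Literature.Probability.LatticeModels.Site 3)}; ∀ t p : ℝ, 0 ≤ t → t < 1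 → 0 ≤ p → 8 * p < 1 - t → θ p t = 0 := by
  sorry

/-- **stub 2 (registered) = `Stubs.stub_planarMinorant` spelled out** — `θ_{ℤ²}(p) ≤ θ(p,t)`:
the `U_e ≤ p` horizontal bonds of the plane `ℤ²×{0}` are a sub-configuration with law
`bondPercolation (zdGraph 2) p`. Size M (push-forward of `labelMeasure` along a plane embedding). -/
theorem stub_planarMinorant :
    let μ := Literature.Probability.Percolation.labelMeasure (Literature.Probability.LatticeModels.Site 3); let vert : Sym2 (Literature.Probability.LatticeModels.Site 3) → Prop := fun e => ∃ x : Literature.Probability.LatticeModels.Site 3, e = s(x, x + Pi.single (2 : Fin 3) 1); let cfg : ℝ → ℝ → (Sym2 (Literature.Probability.LatticeModels.Site 3) → ℝ) → Set (Sym2 (Literature.Probability.LatticeModels.Site 3)) := fun p t U => {e | e ∈ (Literature.Probability.LatticeModels.zdGraph 3).edgeSet ∧ ((vert e ∧ U e ≤ t) ∨ (¬ vert e ∧ U e ≤ p))}; let θ : ℝ → ℝ → ℝ := fun p t => μ.real {U | cfg p t U ∈ Literature.Probability.Percolation.percolatesAt (0 : Literature.Probability.LatticeModels.Site 3)}; ∀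 p : unitInterval, ∀ t : ℝ, Literature.Probability.Percolation.theta (Literature.Probability.LatticeModels.zdGraph 2) 0 p ≤ θ p t := by
  sorry

/-- **stub 3 (registered) = `Stubs.stub_shearMonotone` spelled out** — Aizenman–Grimmett shear
monotonicity of `θ` on compact rectangles of the open square (the load-bearing stub; size L). -/
theorem stub_shearMonotone :
    let μ := Literature.Probability.Percolation.labelMeasure (Literature.Probability.LatticeModels.Site 3); let vert : Sym2 (Literature.Probability.LatticeModels.Site 3) → Prop := fun e => ∃ x : Literature.Probability.LatticeModels.Site 3, e = s(x, x + Pi.single (2 : Fin 3) 1); let cfg : ℝ → ℝ → (Sym2 (Literature.Probability.LatticeModels.Site 3) → ℝ) → Set (Sym2 (Literature.Probability.LatticeModels.Site 3)) := fun p t U => {e | e ∈ (Literature.Probability.LatticeModels.zdGraph 3).edgeSet ∧ ((vert e ∧ U e ≤ t) ∨ (¬ vert e ∧ U e ≤ p))}; let θ : ℝ → ℝ → ℝ := fun p t => μ.real {U | cfg p t U ∈ Literature.Probability.Percolation.percolatesAt (0 : Literature.Probability.LatticeModels.Site 3)}; ∀ lo hi plo phi : ℝ, 0 < lo → lo ≤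 hi → hi < 1 → 0 < plo → plo ≤ phi → phi < 1 → ∃ C : ℝ, 0 ≤ C ∧ ∀ s ∈ Set.Icc lo hi, ∀ t ∈ Set.Icc lo hi, ∀ p : ℝ, plo ≤ p → p + C * |t - s| ≤ phi → θ p t ≤ θ (p + C * |t - s|) s := by
  sorry

/-! ## The real-variable core (proved): threshold curve of a sheared monotone family -/

/-- **Core of the composition (percolation-free, proved).** For any `θ : ℝ → ℝ → ℝ` with
threshold `pc t = sInf ({p ∈ [0,1] | 0 < θ p t} ∪ {1})`: the run bound (`θ = 0` for
`8p < 1 − t`), one density `q₀ < 1` with `θ(q₀, ·) > 0`, and shear monotonicity on compact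
rectangles of `(0,1)²` imply that `pc` is continuous on `(0,1)` with `(1−t)/8 ≤ pc t ≤ q₀`. -/
theorem curve_regular_core {θ : ℝ → ℝ → ℝ} {pc : ℝ → ℝ} {q₀ : ℝ}
    (hpc : ∀ t, pc t = sInf ({p : ℝ | 0 ≤ p ∧ p ≤ 1 ∧ 0 < θ p t} ∪ {1}))
    (h1 : ∀ t p : ℝ, 0 ≤ t → t < 1 → 0 ≤ p → 8 * p < 1 - t → θ p t = 0)
    (hq₀ : 0 ≤ q₀) (hq₁ : q₀ < 1) (h2 : ∀ t : ℝ, 0 < θ q₀ t)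
    (h3 : ∀ lo hi plo phi : ℝ, 0 < lo → lo ≤ hi → hi < 1 → 0 < plo → plo ≤ phi → phi < 1 →
      ∃ C : ℝ, 0 ≤ C ∧ ∀ s ∈ Set.Icc lo hi, ∀ t ∈ Set.Icc lo hi, ∀ p : ℝ, plo ≤ p →
        p + C * |t - s| ≤ phi → θ p t ≤ θ (p + C * |t - s|) s) :
    ContinuousOn pc (Set.Ioo 0 1) ∧ ∀ t ∈ Set.Ioo (0 : ℝ) 1, 0 < pc t ∧ pc t < 1 := by
  -- the set whose infimum is `pc t`
  have hS_ne : ∀ t, ({p : ℝ | 0 ≤ p ∧ p ≤ 1 ∧ 0 < θ p t} ∪ {1}).Nonempty := fun t =>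
    ⟨1, Or.inr rfl⟩
  have hS_bdd : ∀ t, BddBelow ({p : ℝ | 0 ≤ p ∧ p ≤ 1 ∧ 0 < θ p t} ∪ {1}) := fun t =>
    ⟨0, by
      rintro p (⟨hp, -⟩ | hp)
      · exact hp
      · rw [Set.mem_singleton_iff] at hp; rw [hp]; exact zero_le_one⟩
  have hpc_le : ∀ t q, 0 ≤ q → q ≤ 1 → 0 < θ q t → pc t ≤ q := fun t q h0 h1' hpos => by
    rw [hpc]; exact csInf_le (hS_bdd t) (Or.inl ⟨h0, h1', hpos⟩)
  have hpc_le_one : ∀ t, pc t ≤ 1 := fun t => by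
    rw [hpc]; exact csInf_le (hS_bdd t) (Or.inr rfl)
  have hle_pc : ∀ t c, c ≤ 1 → (∀ p, 0 ≤ p → p < c → θ p t ≤ 0) → c ≤ pc t :=
      fun t c hc1 hzero => by
    rw [hpc]
    refine le_csInf (hS_ne t) ?_
    rintro p (⟨hp0, -, hpos⟩ | hp)
    · by_contra hlt
      exact absurd (hzero p hp0 (not_le.mp hlt)) (not_le.mpr hpos)
    · rw [Set.mem_singleton_iff] at hp; rw [hp]; exact hc1
  -- (i) the run bound: a density with `θ > 0` violates `8p < 1 - t`
  have hlow : ∀ t, 0 ≤ t → t < 1 → ∀ q, 0 ≤ q → 0 < θ q t → (1 - t) / 8 ≤ q := by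
    intro t ht0 ht1 q hq0 hpos
    by_contra hlt
    have hz := h1 t q ht0 ht1 hq0 (by linarith [not_le.mp hlt])
    exact absurd hz hpos.ne'
  have hpc_low : ∀ t, 0 ≤ t → t < 1 → (1 - t) / 8 ≤ pc t := fun t ht0 ht1 =>
    hle_pc t _ (by linarith) fun p hp0 hpc' => (h1 t p ht0 ht1 hp0 (by linarith)).le
  -- (ii) the planar bound
  have hpc_up : ∀ t, pc t ≤ q₀ := fun t => hpc_le t q₀ hq₀ hq₁.le (h2 t)
  refine ⟨?_, fun t ht => ⟨lt_of_lt_of_le (by linarith [ht.2]) (hpc_low t ht.1.le ht.2),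
    (hpc_up t).trans_lt hq₁⟩⟩
  -- (iii) continuity at `t₀ ∈ (0,1)`: shear on the rectangle `[(1-t₀)/32, (q₀+1)/2] × [t₀/2, (t₀+1)/2]`
  intro t₀ ht₀
  obtain ⟨ht₀0, ht₀1⟩ := ht₀
  have h1t : 0 < 1 - t₀ := by linarith
  have h1q : 0 < 1 - q₀ := by linarith
  have hlo : 0 < t₀ / 2 := by linarith
  have hlohi : t₀ / 2 ≤ (t₀ + 1) / 2 := by linarith
  have hhi : (t₀ + 1) / 2 < 1 := by linarith
  have hplo : 0 < (1 - t₀) / 32 := by linarith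
  have hplophi : (1 - t₀) / 32 ≤ (q₀ + 1) / 2 := by linarith
  have hphi : (q₀ + 1) / 2 < 1 := by linarith
  obtain ⟨C, hC0, hC⟩ := h3 _ _ _ _ hlo hlohi hhi hplo hplophi hphi
  -- one-sided estimate along the shear, for nearby levels `s, t` of the sub-arc
  have claim : ∀ s ∈ Set.Icc (t₀ / 2) ((t₀ + 1) / 2), ∀ t ∈ Set.Icc (t₀ / 2) ((t₀ + 1) / 2),
      C * |t - s| ≤ (1 - q₀) / 4 → pc s ≤ pc t + C * |t - s| := by
    intro s hs t ht hsmall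
    have hCts : 0 ≤ C * |t - s| := mul_nonneg hC0 (abs_nonneg _)
    refine le_of_forall_pos_lt_add fun ε hε => ?_
    have hε' : 0 < min ε ((1 - q₀) / 4) := lt_min hε (by linarith)
    obtain ⟨q, hqS, hqlt⟩ := exists_lt_of_csInf_lt (hS_ne t)
      (show sInf ({p : ℝ | 0 ≤ p ∧ p ≤ 1 ∧ 0 < θ p t} ∪ {1}) < pc t + min ε ((1 - q₀) / 4) by
        rw [← hpc t]; linarith)
    have hm1 : min ε ((1 - q₀) / 4) ≤ ε := min_le_left _ _
    have hm2 : min ε ((1 - q₀) / 4) ≤ (1 - q₀) / 4 := min_le_right _ _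
    rcases hqS with ⟨hq0, -, hqpos⟩ | hq_one
    · have ht0' : 0 ≤ t := by linarith [ht.1]
      have ht1' : t < 1 := by linarith [ht.2]
      have hq_plo : (1 - t₀) / 32 ≤ q := by
        have := hlow t ht0' ht1' q hq0 hqpos
        linarith [ht.2]
      have hfit : q + C * |t - s| ≤ (q₀ + 1) / 2 := by
        have := hpc_up t
        linarith
      have hmono := hC s hs t ht q hq_plo hfit
      have hpos' : 0 < θ (q + C * |t - s|) s := hqpos.trans_le hmono
      have hle := hpc_le s _ (by linarith) (hfit.trans hphi.le) hpos'
      linarith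
    · rw [Set.mem_singleton_iff] at hq_one
      have := hpc_le_one s
      rw [hq_one] at hqlt
      linarith
  -- continuity within `(0,1)` at `t₀`
  rw [Metric.continuousWithinAt_iff]
  intro ε hε
  have hC1 : 0 < C + 1 := by linarith
  refine ⟨min (min (t₀ / 2) ((1 - t₀) / 2)) (min ((1 - q₀) / (4 * (C + 1))) (ε / (C + 1))),
    lt_min (lt_min hlo (by linarith)) (lt_min (by positivity) (by positivity)), ?_⟩
  intro x hx hdist
  have hd1 : dist x t₀ < t₀ / 2 := hdist.trans_le ((min_le_left _ _).trans (min_le_left _ _))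
  have hd2 : dist x t₀ < (1 - t₀) / 2 :=
    hdist.trans_le ((min_le_left _ _).trans (min_le_right _ _))
  have hd3 : dist x t₀ < (1 - q₀) / (4 * (C + 1)) :=
    hdist.trans_le ((min_le_right _ _).trans (min_le_left _ _))
  have hd4 : dist x t₀ < ε / (C + 1) :=
    hdist.trans_le ((min_le_right _ _).trans (min_le_right _ _))
  rw [Real.dist_eq] at hd1 hd2 hd3 hd4 ⊢
  have hxI : x ∈ Set.Icc (t₀ / 2) ((t₀ + 1) / 2) := by
    constructor <;> linarith [(abs_sub_lt_iff.mp hd1).1, (abs_sub_lt_iff.mp hd1).2,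
      (abs_sub_lt_iff.mp hd2).1, (abs_sub_lt_iff.mp hd2).2]
  have ht₀I : t₀ ∈ Set.Icc (t₀ / 2) ((t₀ + 1) / 2) := ⟨by linarith, by linarith⟩
  have hsmall : C * |x - t₀| ≤ (1 - q₀) / 4 := by
    have h := mul_le_mul_of_nonneg_left hd3.le hC0
    have h' : C * ((1 - q₀) / (4 * (C + 1))) ≤ (1 - q₀) / 4 := by
      rw [mul_div_assoc', div_le_iff₀ (by positivity)]
      nlinarith [h1q, hC0]
    exact h.trans h'
  have hsmall' : C * |t₀ - x| ≤ (1 - q₀) / 4 := by rwa [abs_sub_comm] at hsmall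
  have e1 := claim x hxI t₀ ht₀I hsmall'
  have e2 := claim t₀ ht₀I x hxI hsmall
  rw [abs_sub_comm] at e1
  have hCε : C * |x - t₀| < ε := by
    have h := mul_le_mul_of_nonneg_left hd4.le hC0
    have h' : C * (ε / (C + 1)) < ε := by
      rw [mul_div_assoc', div_lt_iff₀ hC1]
      nlinarith [hε, hC0]
    exact h.trans_lt h'
  rw [abs_sub_lt_iff]
  constructor <;> linarith

/-! ## The composition (proved): the three stubs imply the crux BY NAME -/

/-- **`CriticalCurveRegular` from the three stubs** (hypotheses = the declared stub `Prop`s by name;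
conclusion = the route decl `PercExchangeRateTransport.CriticalCurveRegular` by name; no `sorry`):
instantiate `curve_regular_core` with the family's `θ`, `p_c` (read off the crux by unification),
`q₀ := (p_c(ℤ²)+1)/2`, the tree theorems `0 < p_c(ℤ²) < 1` (Grimmett 1999 Thm (1.10),
`Grimmett1999_criticalProb_pos_lt_one_holds`) and `θ_{ℤ²} > 0` above `p_c(ℤ²)`
(`theta_pos_of_criticalProb_lt_holds`), and the planar minorant. -/
theorem CriticalCurveRegular_of (h1 : Stubs.stub_smallDensityNoPercolation)
    (h2 : Stubs.stub_planarMinorant) (h3 : Stubs.stub_shearMonotone) :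
    Summit.CriticalPhenomena.PercolationContinuityZ3.Theses.PercExchangeRateTransport.CriticalCurveRegular := by
  have h2b := Grimmett1999_criticalProb_pos_lt_one_holds 2 (by norm_num)
  have hq0 : (0 : ℝ) ≤ (criticalProb (zdGraph 2) (0 : Site 2) + 1) / 2 := by linarith [h2b.1]
  have hq1 : (criticalProb (zdGraph 2) (0 : Site 2) + 1) / 2 < 1 := by linarith [h2b.2]
  have hq01 : (criticalProb (zdGraph 2) (0 : Site 2) + 1) / 2 ≤ 1 := hq1.le
  have hθ₂ : 0 < theta (zdGraph 2) 0 ⟨(criticalProb (zdGraph 2) (0 : Site 2) + 1) / 2, hq0, hq01⟩ :=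
    theta_pos_of_criticalProb_lt_holds _ _ _ (by
      show criticalProb (zdGraph 2) 0 < (criticalProb (zdGraph 2) (0 : Site 2) + 1) / 2
      linarith [h2b.2])
  unfold Stubs.stub_smallDensityNoPercolation at h1
  unfold Stubs.stub_planarMinorant at h2
  unfold Stubs.stub_shearMonotone at h3
  exact curve_regular_core (fun _ => rfl) h1 hq0 hq1 (fun t => hθ₂.trans_le (h2 _ t)) h3

/-- **The skeleton IS the crux proof** (D-0027 §3.3): `CriticalCurveRegular` from the three
registered stubs; sorry-free as soon as the three `stub_*` are discharged. -/
theorem CriticalCurveRegular_proof :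
    Summit.CriticalPhenomena.PercolationContinuityZ3.Theses.PercExchangeRateTransport.CriticalCurveRegular :=
  CriticalCurveRegular_of stub_smallDensityNoPercolation stub_planarMinorant stub_shearMonotone

end Summit.CriticalPhenomena.PercolationContinuityZ3.Cruxes.CriticalCurveRegular.Birth

end
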